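import Summits.Ventures.PercRepro.ThetaOmegaGraphFreeCycle

/-!
# The graph form of (Ω): three instances of Conjecture T⁺ in the kernel

Addendum 85 supplement 5 (mine-1, gen 46). Conjecture T⁺ (`OmegaOddCycle`) says that for `|F| ≥ 4`
a hitting family with a non-bipartite free graph has at least `|F| + 1` members. Three concrete
instances, each checked by the kernel (`decide` on the slot triples of the instance):

* `tplus_fails_at_three` — **the hypothesis `4 ≤ |F|` cannot be lowered**: on `U = {0,1,2,3}` the
  family `{∅, {0,1}, {0,1,2}}` has the hitting family `{∅, {0,1,2}, ({2,3})ᵐ}` of THREE members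
  whose free graph contains the pentagon `∅ᵐ – {0,1} – {0,1,2} – {0,1}ᵐ – {0,1,2}ᵐ`;
* `tplus_tight_at_four` — **T⁺ is attained at `|F| = 4`**: `{∅, {0}, {0,1}, {2}}` has a hitting
  family of FIVE members with a free pentagon;
* `tplus_tight_at_five` — **T⁺ is attained at `|F| = 5`**: `{{0,1,3}, {1,2,3}, {0,1,2,3}, {0,1},
  {2,3}}` has a hitting family of SIX members with the free pentagon
  `{0,1,3} – {1,2,3} – {0,1,3}ᵐ – {0,1,2,3} – {1,2,3}ᵐ` (the decoded SAT model of kit j330577).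

Tools: `slotsOf` / `hitsTriples_of_bounded` (the hitting condition bounded to the slots of `F`,
decidable on an instance) and `not_bipartiteFree_of_freePentagon` (a free pentagon admits no
two-colouring: five alternations of a Boolean colour return to the start).
-/

namespace PercRepro.MSTight

open Finset

variable {α : Type*} [DecidableEq α]

/-- The slots of a family: every member with both sides. -/
def slotsOf (F : Finset (Finset α)) : Finset (Slot α) := F ×ˢ Finset.univ

variable {U : Finset α} {F : Finset (Finset α)} {M : Finset (Finset α × Bool)}

omit [DecidableEq α] in
/-- Membership in the slots of a family. -/
theorem mem_slotsOf {u : Slot α} : u ∈ slotsOf F ↔ u.1 ∈ F := by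
  unfold slotsOf
  rw [mem_product]
  exact ⟨fun h => h.1, fun h => ⟨h, mem_univ _⟩⟩

/-- The hitting condition bounded to the slots of `F` (decidable on a concrete instance) gives
`HitsTriples`. -/
theorem hitsTriples_of_bounded
    (h : ∀ u ∈ slotsOf F, ∀ v ∈ slotsOf F, ∀ w ∈ slotsOf F, u ≠ v → u ≠ w → v ≠ w →
      slotMeet U u v ∈ M ∨ slotMeet U u w ∈ M ∨ slotMeet U v w ∈ M) : HitsTriples U F M :=
  fun u v w hu hv hw => h u (mem_slotsOf.2 hu) v (mem_slotsOf.2 hv) w (mem_slotsOf.2 hw)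

/-- **A free pentagon admits no two-colouring**: consecutive slots of the pentagon must get
different colours, and five alternations of a Boolean colour cannot close up. -/
theorem not_bipartiteFree_of_freePentagon {v : Fin 5 → Slot α} (hv : FreePentagon U F M v) :
    ¬ BipartiteFree U F M := by
  rintro ⟨χ, hχ⟩
  obtain ⟨hF, hinj, hfree⟩ := hv
  have step : ∀ i : Fin 5, χ (v i) ≠ χ (v (i + 1)) := by
    intro i h
    have hne : v i ≠ v (i + 1) := fun h' => by
      have := hinj h'
      omega
    exact hfree i (hχ _ _ (hF _) (hF _) hne h)
  have h0 := step 0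
  have h1 := step 1
  have h2 := step 2
  have h3 := step 3
  have h4 := step 4
  simp only [show (0 : Fin 5) + 1 = 1 from rfl, show (1 : Fin 5) + 1 = 2 from rfl,
    show (2 : Fin 5) + 1 = 3 from rfl, show (3 : Fin 5) + 1 = 4 from rfl,
    show (4 : Fin 5) + 1 = 0 from rfl] at h0 h1 h2 h3 h4
  revert h0 h1 h2 h3 h4
  cases χ (v 0) <;> cases χ (v 1) <;> cases χ (v 2) <;> cases χ (v 3) <;> cases χ (v 4) <;> decide

section Instances

/-- The ground set of the instances: four points. -/
def instU : Finset (Fin 4) := {0, 1, 2, 3}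

/-- **|F| = 3**: the family `{∅, {0,1}, {0,1,2}}`. -/
def instF3 : Finset (Finset (Fin 4)) := {∅, {0, 1}, {0, 1, 2}}

/-- A hitting family of three members for `instF3`. -/
def instM3 : Finset (Finset (Fin 4) × Bool) := {(∅, false), ({0, 1, 2}, false), ({2, 3}, true)}

/-- The free pentagon of `instM3`: `∅ᵐ – {0,1} – {0,1,2} – {0,1}ᵐ – {0,1,2}ᵐ`. -/
def instV3 : Fin 5 → Slot (Fin 4) :=
  ![(∅, true), ({0, 1}, false), ({0, 1, 2}, false), ({0, 1}, true), ({0, 1, 2}, true)]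

/-- **T⁺ fails at `|F| = 3`**: a hitting family of three members with a free pentagon. -/
theorem tplus_fails_at_three :
    HitsTriples instU instF3 instM3 ∧ ¬ BipartiteFree instU instF3 instM3 ∧
      instF3.card = 3 ∧ instM3.card = 3 := by
  refine ⟨hitsTriples_of_bounded ?_, not_bipartiteFree_of_freePentagon (v := instV3) ?_, ?_, ?_⟩
  · decide
  · unfold FreePentagon
    decide
  · decide
  · decide

/-- **|F| = 4**: the family `{∅, {0}, {0,1}, {2}}`. -/
def instF4 : Finset (Finset (Fin 4)) := {∅, {0}, {0, 1}, {2}}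

/-- A hitting family of five members for `instF4`. -/
def instM4 : Finset (Finset (Fin 4) × Bool) :=
  {(∅, false), ({0, 1}, false), ({0, 1, 3}, true), ({2, 3}, true), ({1, 2, 3}, true)}

/-- The free pentagon of `instM4`: `{0,1} – {0} – ∅ᵐ – {2} – {0}ᵐ`. -/
def instV4 : Fin 5 → Slot (Fin 4) :=
  ![({0, 1}, false), ({0}, false), (∅, true), ({2}, false), ({0}, true)]

/-- **T⁺ is attained at `|F| = 4`**: a hitting family of five members with a free pentagon. -/
theorem tplus_tight_at_four :
    HitsTriples instU instF4 instM4 ∧ ¬ BipartiteFree instU instF4 instM4 ∧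
      instF4.card = 4 ∧ instM4.card = 5 := by
  refine ⟨hitsTriples_of_bounded ?_, not_bipartiteFree_of_freePentagon (v := instV4) ?_, ?_, ?_⟩
  · decide
  · unfold FreePentagon
    decide
  · decide
  · decide

/-- **|F| = 5**: the family `{{0,1,3}, {1,2,3}, {0,1,2,3}, {0,1}, {2,3}}`. -/
def instF5 : Finset (Finset (Fin 4)) := {{0, 1, 3}, {1, 2, 3}, {0, 1, 2, 3}, {0, 1}, {2, 3}}

/-- A hitting family of six members for `instF5`. -/
def instM5 : Finset (Finset (Fin 4) × Bool) :=
  {(∅, false), ({0, 1}, false), ({0, 1, 3}, false), ({2, 3}, false), ({1, 2, 3}, false), (∅, true)}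

/-- The free pentagon of `instM5`: `{0,1,3} – {1,2,3} – {0,1,3}ᵐ – {0,1,2,3} – {1,2,3}ᵐ`. -/
def instV5 : Fin 5 → Slot (Fin 4) :=
  ![({0, 1, 3}, false), ({1, 2, 3}, false), ({0, 1, 3}, true), ({0, 1, 2, 3}, false),
    ({1, 2, 3}, true)]

/-- **T⁺ is attained at `|F| = 5`**: a hitting family of six members with a free pentagon. -/
theorem tplus_tight_at_five :
    HitsTriples instU instF5 instM5 ∧ ¬ BipartiteFree instU instF5 instM5 ∧
      instF5.card = 5 ∧ instM5.card = 6 := by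
  refine ⟨hitsTriples_of_bounded ?_, not_bipartiteFree_of_freePentagon (v := instV5) ?_, ?_, ?_⟩
  · decide
  · unfold FreePentagon
    decide
  · decide
  · decide

end Instances

end PercRepro.MSTight
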